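import Summits.CriticalPhenomena.CardyFormulaZ2.Theorems.CardyBoundaryCoulombGasStripClusterRatesRectBoxDictionary
import HarnessLib

/-!
# `stub_z2BoxesToRectCardy`, part 2: the discrete arcs of the vertical sides of `(0,w)×(0,h)`

Support file for line `birth` of crux `BoxFamilyToCardy` (stmt-CriticalPhenomena-14215), stub
`stub_z2BoxesToRectCardy`; first lattice half of the sibling line's `RectValue … stub_boxSandwich`.
For the open box `Ω = (0,w)×(0,h)` (real `w, h > 0`) at ANY mesh `δ > 0`, with the closed vertical
sides `L = {re = 0, 0 ≤ im ≤ h}`, `Rt = {re = w, 0 ≤ im ≤ h}` as crossing arcs (this generalises the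
tree's `RectBox.discreteArc_left/right` of `…StripClusterRatesRectCardyOneArcs/…RectBoxDictionary`,
which treat `(0,A)×(0,1)` at mesh `1/k`), the closest-arc rule (Smirnov 2001 §2, tree `discreteArc`)
gives:

* the discrete arc of `L` lies in the FIRST column of the lattice box and contains every first-column
  vertex `(1, b)` with `δ(b+1) ≤ h` (all rows but possibly the top one), provided `2δ ≤ w`
  (`discreteArc_leftSide_subset`, `mem_discreteArc_leftSide`);
* the discrete arc of `Rt` lies in the LAST column (the vertices whose right neighbour leaves the box)
  and contains every last-column vertex below the top row (`discreteArc_rightSide_subset`,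
  `mem_discreteArc_rightSide`).
Registered sub-goal: `rect_discreteArcSides`. No definitions are introduced.

References: S. Smirnov, C. R. Acad. Sci. Paris 333 (2001) 239, §2 [Smirnov2001].
-/

noncomputable section

namespace Summit.CriticalPhenomena.CardyFormulaZ2.Cruxes.BoxFamilyToCardy.Birth

open Set Metric Complex MeasureTheory
open Literature.Probability.LatticeModels Literature.Probability.Percolation
open Summit.CriticalPhenomena.CardyFormulaZ2.Cruxes.StripClusterRates.TwoClusterRateIsStationaryGap
open Summit.CriticalPhenomena.CardyFormulaZ2.Cruxes.HalfPlaneMarkDensityLaw.SketchLine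
  (BoxExhaustion.openConnIn_meshDomain_of_reachable)

namespace RectLattice

variable {w h δ : ℝ}

/-! ## Distances from a point of the closed box to the two vertical sides and to the rest -/

/-- Distance to the foot on the top line `im = h`. [folklore] -/
theorem dist_foot_top (p : ℂ) (hy : p.im ≤ h) :
    dist p (((p.re : ℝ) : ℂ) + (h : ℂ) * I) = h - p.im := by
  rw [dist_eq_norm]
  have e : p - (((p.re : ℝ) : ℂ) + (h : ℂ) * I) = ((p.im - h : ℝ) : ℂ) * I := by
    apply Complex.ext <;> simp
  rw [e, norm_mul, Complex.norm_real, Complex.norm_I, mul_one, Real.norm_eq_abs,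
    abs_of_nonpos (by linarith)]
  ring

/-- Distance from a point with `re ≥ 0`, `0 ≤ im ≤ h` to the closed left side is its real part.
[folklore] -/
theorem infDist_leftSide_eq {p : ℂ} (hx : 0 ≤ p.re) (hy : 0 ≤ p.im ∧ p.im ≤ h) :
    infDist p {z : ℂ | z.re = 0 ∧ 0 ≤ z.im ∧ z.im ≤ h} = p.re := by
  have hmem : (p.im : ℂ) * I ∈ {z : ℂ | z.re = 0 ∧ 0 ≤ z.im ∧ z.im ≤ h} :=
    ⟨by simp, by simpa using hy.1, by simpa using hy.2⟩
  refine le_antisymm ((infDist_le_dist_of_mem hmem).trans_eq (RectBox.dist_foot_left p hx)) ?_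
  refine (le_infDist ⟨_, hmem⟩).2 fun q hq ↦ ?_
  have := (RectBox.re_im_sub_le_dist p q).1
  rw [hq.1] at this; linarith

/-- Distance from a point with `re ≤ w`, `0 ≤ im ≤ h` to the closed right side is `w - re`.
[folklore] -/
theorem infDist_rightSide_eq {p : ℂ} (hx : p.re ≤ w) (hy : 0 ≤ p.im ∧ p.im ≤ h) :
    infDist p {z : ℂ | z.re = w ∧ 0 ≤ z.im ∧ z.im ≤ h} = w - p.re := by
  have hmem : (w : ℂ) + (p.im : ℂ) * I ∈ {z : ℂ | z.re = w ∧ 0 ≤ z.im ∧ z.im ≤ h} :=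
    ⟨by simp, by simpa using hy.1, by simpa using hy.2⟩
  refine le_antisymm ((infDist_le_dist_of_mem hmem).trans_eq (RectBox.dist_foot_right p hx)) ?_
  refine (le_infDist ⟨_, hmem⟩).2 fun q hq ↦ ?_
  have := (RectBox.re_im_sub_le_dist p q).2.1
  rw [hq.1] at this; linarith

/-- Lower bound for the distance from `p` to the frontier of the box minus the left side. [folklore] -/
theorem le_dist_of_mem_frontier_diff_leftSide (hw : 0 < w) (hh : 0 < h) {p q : ℂ}
    (hq : q ∈ frontier (Ioo (0 : ℝ) w ×ℂ Ioo (0 : ℝ) h) \ {z : ℂ | z.re = 0 ∧ 0 ≤ z.im ∧ z.im ≤ h}) :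
    min p.im (min (h - p.im) (w - p.re)) ≤ dist p q := by
  obtain ⟨hqf, hqL⟩ := hq
  obtain ⟨h1, h2, h3, h4⟩ := RectBox.re_im_sub_le_dist p q
  rcases (RectBox.mem_frontier_obox hw hh).1 hqf with ⟨-, him | him⟩ | ⟨hre | hre, him⟩
  · rw [him] at h3; exact (min_le_left _ _).trans (by linarith)
  · rw [him] at h4; exact (min_le_right _ _).trans ((min_le_left _ _).trans (by linarith))
  · exact absurd ⟨hre, him.1, him.2⟩ hqL
  · rw [hre] at h2; exact (min_le_right _ _).trans ((min_le_right _ _).trans (by linarith))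

/-- Lower bound for the distance from `p` to the frontier of the box minus the right side. [folklore] -/
theorem le_dist_of_mem_frontier_diff_rightSide (hw : 0 < w) (hh : 0 < h) {p q : ℂ}
    (hq : q ∈ frontier (Ioo (0 : ℝ) w ×ℂ Ioo (0 : ℝ) h) \ {z : ℂ | z.re = w ∧ 0 ≤ z.im ∧ z.im ≤ h}) :
    min p.im (min (h - p.im) p.re) ≤ dist p q := by
  obtain ⟨hqf, hqR⟩ := hq
  obtain ⟨h1, h2, h3, h4⟩ := RectBox.re_im_sub_le_dist p q
  rcases (RectBox.mem_frontier_obox hw hh).1 hqf with ⟨-, him | him⟩ | ⟨hre | hre, him⟩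
  · rw [him] at h3; exact (min_le_left _ _).trans (by linarith)
  · rw [him] at h4; exact (min_le_right _ _).trans ((min_le_left _ _).trans (by linarith))
  · rw [hre] at h1; exact (min_le_right _ _).trans ((min_le_right _ _).trans (by linarith))
  · exact absurd ⟨hre, him.1, him.2⟩ hqR

/-- Upper bounds for the distance from an interior-column point to the frontier minus the left side:
the feet on the bottom, top and right sides. [folklore] -/
theorem infDist_frontier_diff_leftSide_le (hw : 0 < w) (hh : 0 < h) {p : ℂ}
    (hx : 0 < p.re ∧ p.re < w) (hy : 0 ≤ p.im ∧ p.im ≤ h) :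
    infDist p (frontier (Ioo (0 : ℝ) w ×ℂ Ioo (0 : ℝ) h) \ {z : ℂ | z.re = 0 ∧ 0 ≤ z.im ∧ z.im ≤ h}) ≤ p.im ∧
    infDist p (frontier (Ioo (0 : ℝ) w ×ℂ Ioo (0 : ℝ) h) \ {z : ℂ | z.re = 0 ∧ 0 ≤ z.im ∧ z.im ≤ h}) ≤ h - p.im ∧
    infDist p (frontier (Ioo (0 : ℝ) w ×ℂ Ioo (0 : ℝ) h) \ {z : ℂ | z.re = 0 ∧ 0 ≤ z.im ∧ z.im ≤ h}) ≤ w - p.re := by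
  have hb : ((p.re : ℝ) : ℂ) ∈
      frontier (Ioo (0 : ℝ) w ×ℂ Ioo (0 : ℝ) h) \ {z : ℂ | z.re = 0 ∧ 0 ≤ z.im ∧ z.im ≤ h} := by
    refine ⟨(RectBox.mem_frontier_obox hw hh).2 (Or.inl ⟨?_, Or.inl (by simp)⟩), fun hm ↦ ?_⟩
    · simpa using ⟨hx.1.le, hx.2.le⟩
    · have := hm.1; simp at this; exact hx.1.ne' this
  have ht : (((p.re : ℝ) : ℂ) + (h : ℂ) * I) ∈
      frontier (Ioo (0 : ℝ) w ×ℂ Ioo (0 : ℝ) h) \ {z : ℂ | z.re = 0 ∧ 0 ≤ z.im ∧ z.im ≤ h} := by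
    refine ⟨(RectBox.mem_frontier_obox hw hh).2 (Or.inl ⟨?_, Or.inr (by simp)⟩), fun hm ↦ ?_⟩
    · simpa using ⟨hx.1.le, hx.2.le⟩
    · have := hm.1; simp at this; exact hx.1.ne' this
  have hr : ((w : ℂ) + (p.im : ℂ) * I) ∈
      frontier (Ioo (0 : ℝ) w ×ℂ Ioo (0 : ℝ) h) \ {z : ℂ | z.re = 0 ∧ 0 ≤ z.im ∧ z.im ≤ h} := by
    refine ⟨(RectBox.mem_frontier_obox hw hh).2 (Or.inr ⟨Or.inr (by simp), ?_⟩), fun hm ↦ ?_⟩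
    · simpa using hy
    · have := hm.1; simp at this; exact hw.ne' this
  exact ⟨(infDist_le_dist_of_mem hb).trans_eq (RectBox.dist_foot_bottom p hy.1),
    (infDist_le_dist_of_mem ht).trans_eq (dist_foot_top p hy.2),
    (infDist_le_dist_of_mem hr).trans_eq (RectBox.dist_foot_right p hx.2.le)⟩

/-- Upper bounds for the distance from an interior-column point to the frontier minus the right
side: the feet on the bottom, top and left sides. [folklore] -/
theorem infDist_frontier_diff_rightSide_le (hw : 0 < w) (hh : 0 < h) {p : ℂ}
    (hx : 0 < p.re ∧ p.re < w) (hy : 0 ≤ p.im ∧ p.im ≤ h) :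
    infDist p (frontier (Ioo (0 : ℝ) w ×ℂ Ioo (0 : ℝ) h) \ {z : ℂ | z.re = w ∧ 0 ≤ z.im ∧ z.im ≤ h}) ≤ p.im ∧
    infDist p (frontier (Ioo (0 : ℝ) w ×ℂ Ioo (0 : ℝ) h) \ {z : ℂ | z.re = w ∧ 0 ≤ z.im ∧ z.im ≤ h}) ≤ h - p.im ∧
    infDist p (frontier (Ioo (0 : ℝ) w ×ℂ Ioo (0 : ℝ) h) \ {z : ℂ | z.re = w ∧ 0 ≤ z.im ∧ z.im ≤ h}) ≤ p.re := by
  have hb : ((p.re : ℝ) : ℂ) ∈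
      frontier (Ioo (0 : ℝ) w ×ℂ Ioo (0 : ℝ) h) \ {z : ℂ | z.re = w ∧ 0 ≤ z.im ∧ z.im ≤ h} := by
    refine ⟨(RectBox.mem_frontier_obox hw hh).2 (Or.inl ⟨?_, Or.inl (by simp)⟩), fun hm ↦ ?_⟩
    · simpa using ⟨hx.1.le, hx.2.le⟩
    · have := hm.1; simp at this; exact hx.2.ne this
  have ht : (((p.re : ℝ) : ℂ) + (h : ℂ) * I) ∈
      frontier (Ioo (0 : ℝ) w ×ℂ Ioo (0 : ℝ) h) \ {z : ℂ | z.re = w ∧ 0 ≤ z.im ∧ z.im ≤ h} := by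
    refine ⟨(RectBox.mem_frontier_obox hw hh).2 (Or.inl ⟨?_, Or.inr (by simp)⟩), fun hm ↦ ?_⟩
    · simpa using ⟨hx.1.le, hx.2.le⟩
    · have := hm.1; simp at this; exact hx.2.ne this
  have hl : ((p.im : ℂ) * I) ∈
      frontier (Ioo (0 : ℝ) w ×ℂ Ioo (0 : ℝ) h) \ {z : ℂ | z.re = w ∧ 0 ≤ z.im ∧ z.im ≤ h} := by
    refine ⟨(RectBox.mem_frontier_obox hw hh).2 (Or.inr ⟨Or.inl (by simp), ?_⟩), fun hm ↦ ?_⟩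
    · simpa using hy
    · have := hm.1; simp at this; exact hw.ne' this.symm
  exact ⟨(infDist_le_dist_of_mem hb).trans_eq (RectBox.dist_foot_bottom p hy.1),
    (infDist_le_dist_of_mem ht).trans_eq (dist_foot_top p hy.2),
    (infDist_le_dist_of_mem hl).trans_eq (RectBox.dist_foot_left p hx.1.le)⟩

/-! ## The discrete arcs of the two vertical sides -/

/-- Lattice coordinates of a mesh vertex of the box: both are `≥ 1`. [folklore] -/
theorem one_le_of_mem_meshVertices (hδ : 0 < δ) {v : Site 2}
    (hv : v ∈ meshVertices (Ioo (0 : ℝ) w ×ℂ Ioo (0 : ℝ) h) δ) : 1 ≤ v 0 ∧ 1 ≤ v 1 := by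
  obtain ⟨⟨h00, -⟩, h10, -⟩ := RectBox.mem_meshVertices_obox.1 hv
  have hv0 : (0 : ℤ) < v 0 := by exact_mod_cast pos_of_mul_pos_right h00 hδ.le
  have hv1 : (0 : ℤ) < v 1 := by exact_mod_cast pos_of_mul_pos_right h10 hδ.le
  omega

/-- A lattice neighbour outside the lattice box violates one of the four defining inequalities.
[folklore] -/
theorem not_mem_meshVertices_cases (hδ : 0 < δ) {u : Site 2}
    (hu : u ∉ meshVertices (Ioo (0 : ℝ) w ×ℂ Ioo (0 : ℝ) h) δ) :
    u 0 ≤ 0 ∨ w ≤ δ * u 0 ∨ u 1 ≤ 0 ∨ h ≤ δ * u 1 := by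
  by_contra hcon
  push Not at hcon
  obtain ⟨k0, k0', k1, k1'⟩ := hcon
  have k0r : (0 : ℝ) < u 0 := by exact_mod_cast k0
  have k1r : (0 : ℝ) < u 1 := by exact_mod_cast k1
  exact hu (RectBox.mem_meshVertices_obox.2 ⟨⟨mul_pos hδ k0r, k0'⟩, mul_pos hδ k1r, k1'⟩)

/-- **The discrete arc of the left side lies in the first column** of the lattice box (any mesh).
[folklore] -/
theorem discreteArc_leftSide_subset (hw : 0 < w) (hh : 0 < h) (hδ : 0 < δ) {v : Site 2}
    (hv : v ∈ discreteArc (Ioo (0 : ℝ) w ×ℂ Ioo (0 : ℝ) h) δ {z : ℂ | z.re = 0 ∧ 0 ≤ z.im ∧ z.im ≤ h}) :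
    v ∈ meshVertices (Ioo (0 : ℝ) w ×ℂ Ioo (0 : ℝ) h) δ ∧ v 0 = 1 := by
  obtain ⟨hvb, hdist⟩ := hv
  obtain ⟨hvV, u, hadj, huV⟩ := RectBox.exists_adj_not_mem_of_mem_meshBoundary_obox hδ hvb
  refine ⟨hvV, ?_⟩
  obtain ⟨⟨h00, h0w⟩, h10, h1h⟩ := RectBox.mem_meshVertices_obox.1 hvV
  obtain ⟨hv0, hv1⟩ := one_le_of_mem_meshVertices hδ hvV
  have hv0r : (1 : ℝ) ≤ v 0 := by exact_mod_cast hv0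
  have hv1r : (1 : ℝ) ≤ v 1 := by exact_mod_cast hv1
  -- the distance comparison in coordinates
  have hpre : (meshPoint δ v).re = δ * v 0 := meshPoint_re δ v
  have hpim : (meshPoint δ v).im = δ * v 1 := meshPoint_im δ v
  have hxI : 0 < (meshPoint δ v).re ∧ (meshPoint δ v).re < w := by rw [hpre]; exact ⟨h00, h0w⟩
  have hyI : 0 ≤ (meshPoint δ v).im ∧ (meshPoint δ v).im ≤ h := by rw [hpim]; exact ⟨h10.le, h1h.le⟩
  obtain ⟨hb, ht, hr⟩ := infDist_frontier_diff_leftSide_le hw hh hxI hyI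
  rw [infDist_leftSide_eq hxI.1.le hyI, hpre] at hdist
  rw [hpim] at hb ht
  rw [hpre] at hr
  have hc1 : δ * v 0 ≤ δ * v 1 := hdist.trans hb
  have hc2 : δ * v 0 ≤ h - δ * v 1 := hdist.trans ht
  have hc3 : δ * v 0 ≤ w - δ * v 0 := hdist.trans hr
  -- the missing neighbour
  obtain ⟨a0, b0⟩ := zdGraph_adj_apply_le hadj 0
  obtain ⟨a1, b1⟩ := zdGraph_adj_apply_le hadj 1
  have a0r : (u 0 : ℝ) ≤ v 0 + 1 := by exact_mod_cast a0
  have a1r : (u 1 : ℝ) ≤ v 1 + 1 := by exact_mod_cast a1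
  suffices hle : δ * (v 0 : ℝ) ≤ δ * 1 by
    have h' : (v 0 : ℝ) ≤ 1 := le_of_mul_le_mul_left hle hδ
    have : v 0 ≤ 1 := by exact_mod_cast h'
    omega
  rcases not_mem_meshVertices_cases hδ huV with k | k | k | k
  · have : v 0 ≤ 1 := by omega
    have : (v 0 : ℝ) ≤ 1 := by exact_mod_cast this
    exact mul_le_mul_of_nonneg_left this hδ.le
  · have : δ * u 0 ≤ δ * (v 0 + 1) := mul_le_mul_of_nonneg_left a0r hδ.le
    linarith
  · have hv1' : v 1 = 1 := by omega
    have : (v 1 : ℝ) = 1 := by exact_mod_cast hv1'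
    rw [this] at hc1
    linarith
  · have : δ * u 1 ≤ δ * (v 1 + 1) := mul_le_mul_of_nonneg_left a1r hδ.le
    linarith

/-- **The discrete arc of the right side lies in the last column** of the lattice box (the column
whose right neighbours leave the box; any mesh). [folklore] -/
theorem discreteArc_rightSide_subset (hw : 0 < w) (hh : 0 < h) (hδ : 0 < δ) {v : Site 2}
    (hv : v ∈ discreteArc (Ioo (0 : ℝ) w ×ℂ Ioo (0 : ℝ) h) δ {z : ℂ | z.re = w ∧ 0 ≤ z.im ∧ z.im ≤ h}) :
    v ∈ meshVertices (Ioo (0 : ℝ) w ×ℂ Ioo (0 : ℝ) h) δ ∧ w ≤ δ * (v 0 + 1) := by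
  obtain ⟨hvb, hdist⟩ := hv
  obtain ⟨hvV, u, hadj, huV⟩ := RectBox.exists_adj_not_mem_of_mem_meshBoundary_obox hδ hvb
  refine ⟨hvV, ?_⟩
  obtain ⟨⟨h00, h0w⟩, h10, h1h⟩ := RectBox.mem_meshVertices_obox.1 hvV
  obtain ⟨hv0, hv1⟩ := one_le_of_mem_meshVertices hδ hvV
  have hv0r : (1 : ℝ) ≤ v 0 := by exact_mod_cast hv0
  have hv1r : (1 : ℝ) ≤ v 1 := by exact_mod_cast hv1
  have hpre : (meshPoint δ v).re = δ * v 0 := meshPoint_re δ v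
  have hpim : (meshPoint δ v).im = δ * v 1 := meshPoint_im δ v
  have hxI : 0 < (meshPoint δ v).re ∧ (meshPoint δ v).re < w := by rw [hpre]; exact ⟨h00, h0w⟩
  have hyI : 0 ≤ (meshPoint δ v).im ∧ (meshPoint δ v).im ≤ h := by rw [hpim]; exact ⟨h10.le, h1h.le⟩
  obtain ⟨hb, ht, hl⟩ := infDist_frontier_diff_rightSide_le hw hh hxI hyI
  rw [infDist_rightSide_eq hxI.2.le hyI, hpre] at hdist
  rw [hpim] at hb ht
  rw [hpre] at hl
  have hc1 : w - δ * v 0 ≤ δ * v 1 := hdist.trans hb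
  have hc2 : w - δ * v 0 ≤ h - δ * v 1 := hdist.trans ht
  have hc3 : w - δ * v 0 ≤ δ * v 0 := hdist.trans hl
  obtain ⟨a0, b0⟩ := zdGraph_adj_apply_le hadj 0
  obtain ⟨a1, b1⟩ := zdGraph_adj_apply_le hadj 1
  have a0r : (u 0 : ℝ) ≤ v 0 + 1 := by exact_mod_cast a0
  have a1r : (u 1 : ℝ) ≤ v 1 + 1 := by exact_mod_cast a1
  rcases not_mem_meshVertices_cases hδ huV with k | k | k | k
  · have hv0' : v 0 = 1 := by omega
    have : (v 0 : ℝ) = 1 := by exact_mod_cast hv0'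
    rw [this] at hc3 ⊢
    linarith
  · have : δ * u 0 ≤ δ * (v 0 + 1) := mul_le_mul_of_nonneg_left a0r hδ.le
    linarith
  · have hv1' : v 1 = 1 := by omega
    have : (v 1 : ℝ) = 1 := by exact_mod_cast hv1'
    rw [this] at hc1
    linarith
  · have : δ * u 1 ≤ δ * (v 1 + 1) := mul_le_mul_of_nonneg_left a1r hδ.le
    linarith

/-- **First-column vertices below the top row lie in the discrete arc of the left side** (mesh
`2δ ≤ w`). [folklore] -/
theorem mem_discreteArc_leftSide (hw : 0 < w) (hh : 0 < h) (hδ : 0 < δ) (h2 : 2 * δ ≤ w) {v : Site 2}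
    (hv : v ∈ meshVertices (Ioo (0 : ℝ) w ×ℂ Ioo (0 : ℝ) h) δ) (hv0 : v 0 = 1)
    (hv1 : δ * (v 1 + 1) ≤ h) :
    v ∈ discreteArc (Ioo (0 : ℝ) w ×ℂ Ioo (0 : ℝ) h) δ {z : ℂ | z.re = 0 ∧ 0 ≤ z.im ∧ z.im ≤ h} := by
  obtain ⟨⟨h00, h0w⟩, h10, h1h⟩ := RectBox.mem_meshVertices_obox.1 hv
  obtain ⟨-, hv1'⟩ := one_le_of_mem_meshVertices hδ hv
  have hv0r : (v 0 : ℝ) = 1 := by exact_mod_cast hv0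
  have hv1r : (1 : ℝ) ≤ v 1 := by exact_mod_cast hv1'
  have hpre : (meshPoint δ v).re = δ * v 0 := meshPoint_re δ v
  have hpim : (meshPoint δ v).im = δ * v 1 := meshPoint_im δ v
  refine ⟨RectBox.mem_meshBoundary_obox hδ hv (w := v - Pi.single 0 1) ?_ ?_, ?_⟩
  · rw [zdGraph_adj_iff]; exact ⟨0, Or.inr (by simp)⟩
  · intro hm
    have := (one_le_of_mem_meshVertices hδ hm).1
    simp [hv0] at this
  · have hx : 0 ≤ (meshPoint δ v).re := by rw [hpre]; exact h00.le
    have hy : 0 ≤ (meshPoint δ v).im ∧ (meshPoint δ v).im ≤ h := by rw [hpim]; exact ⟨h10.le, h1h.le⟩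
    rw [infDist_leftSide_eq hx hy]
    have hne : (frontier (Ioo (0 : ℝ) w ×ℂ Ioo (0 : ℝ) h) \
        {z : ℂ | z.re = 0 ∧ 0 ≤ z.im ∧ z.im ≤ h}).Nonempty := by
      refine ⟨(w : ℂ), (RectBox.mem_frontier_obox hw hh).2 (Or.inr ⟨Or.inr (by simp), by simp [hh.le]⟩), ?_⟩
      intro hm; have := hm.1; simp at this; exact hw.ne' this
    refine (le_infDist hne).2 fun q hq ↦ le_trans ?_ (le_dist_of_mem_frontier_diff_leftSide hw hh hq)
    rw [hpre, hpim, hv0r, mul_one]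
    refine le_min (by nlinarith) (le_min (by linarith) (by linarith))

/-- **Last-column vertices below the top row lie in the discrete arc of the right side** (any mesh).
[folklore] -/
theorem mem_discreteArc_rightSide (hw : 0 < w) (hh : 0 < h) (hδ : 0 < δ) {v : Site 2}
    (hv : v ∈ meshVertices (Ioo (0 : ℝ) w ×ℂ Ioo (0 : ℝ) h) δ) (hv0 : w ≤ δ * (v 0 + 1))
    (hv1 : δ * (v 1 + 1) ≤ h) :
    v ∈ discreteArc (Ioo (0 : ℝ) w ×ℂ Ioo (0 : ℝ) h) δ {z : ℂ | z.re = w ∧ 0 ≤ z.im ∧ z.im ≤ h} := by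
  obtain ⟨⟨h00, h0w⟩, h10, h1h⟩ := RectBox.mem_meshVertices_obox.1 hv
  obtain ⟨hv0', hv1'⟩ := one_le_of_mem_meshVertices hδ hv
  have hv0r : (1 : ℝ) ≤ v 0 := by exact_mod_cast hv0'
  have hv1r : (1 : ℝ) ≤ v 1 := by exact_mod_cast hv1'
  have hpre : (meshPoint δ v).re = δ * v 0 := meshPoint_re δ v
  have hpim : (meshPoint δ v).im = δ * v 1 := meshPoint_im δ v
  refine ⟨RectBox.mem_meshBoundary_obox hδ hv (w := v + Pi.single 0 1) ?_ ?_, ?_⟩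
  · rw [zdGraph_adj_iff]; exact ⟨0, Or.inl rfl⟩
  · intro hm
    obtain ⟨⟨-, hlt⟩, -⟩ := RectBox.mem_meshVertices_obox.1 hm
    simp only [Pi.add_apply, Pi.single_eq_same, Int.cast_add, Int.cast_one] at hlt
    linarith
  · have hx : (meshPoint δ v).re ≤ w := by rw [hpre]; exact h0w.le
    have hy : 0 ≤ (meshPoint δ v).im ∧ (meshPoint δ v).im ≤ h := by rw [hpim]; exact ⟨h10.le, h1h.le⟩
    rw [infDist_rightSide_eq hx hy]
    have hne : (frontier (Ioo (0 : ℝ) w ×ℂ Ioo (0 : ℝ) h) \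
        {z : ℂ | z.re = w ∧ 0 ≤ z.im ∧ z.im ≤ h}).Nonempty := by
      refine ⟨(0 : ℂ), (RectBox.mem_frontier_obox hw hh).2 (Or.inr ⟨Or.inl (by simp), by simp [hh.le]⟩), ?_⟩
      intro hm; have := hm.1; simp at this; exact hw.ne' this.symm
    refine (le_infDist hne).2 fun q hq ↦ le_trans ?_ (le_dist_of_mem_frontier_diff_rightSide hw hh hq)
    rw [hpre, hpim]
    have hg : w - δ * v 0 ≤ δ := by linarith
    refine le_min (by nlinarith) (le_min (by linarith) (by nlinarith))

end RectLattice

open RectLattice in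
/-- **Registered sub-goal `rect_discreteArcSides`** (part 2 of stub `stub_z2BoxesToRectCardy`): at any
mesh `δ > 0`, the discrete arc of the left side of `(0,w)×(0,h)` lies in the first column of the
lattice box and the discrete arc of the right side in its last column. [folklore] -/
theorem rect_discreteArcSides : ∀ (w h δ : ℝ), 0 < w → 0 < h → 0 < δ →
    ∀ v : Literature.Probability.LatticeModels.Site 2,
      (v ∈ Literature.Probability.LatticeModels.discreteArc (Set.Ioo (0:ℝ) w ×ℂ Set.Ioo (0:ℝ) h) δ
          {z : ℂ | z.re = 0 ∧ 0 ≤ z.im ∧ z.im ≤ h} →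
        v ∈ Literature.Probability.LatticeModels.meshVertices (Set.Ioo (0:ℝ) w ×ℂ Set.Ioo (0:ℝ) h) δ ∧ v 0 = 1) ∧
      (v ∈ Literature.Probability.LatticeModels.discreteArc (Set.Ioo (0:ℝ) w ×ℂ Set.Ioo (0:ℝ) h) δ
          {z : ℂ | z.re = w ∧ 0 ≤ z.im ∧ z.im ≤ h} →
        v ∈ Literature.Probability.LatticeModels.meshVertices (Set.Ioo (0:ℝ) w ×ℂ Set.Ioo (0:ℝ) h) δ ∧
          w ≤ δ * (v 0 + 1)) :=
  fun _ _ _ hw hh hδ _ => ⟨discreteArc_leftSide_subset hw hh hδ, discreteArc_rightSide_subset hw hh hδ⟩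

end Summit.CriticalPhenomena.CardyFormulaZ2.Cruxes.BoxFamilyToCardy.Birth

end
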